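import Literature.NumberTheory.DiophantineGeometry.FunctionFieldResidues
import Literature.NumberTheory.DiophantineGeometry.FunctionFieldArtinSchreierIrreducible
import Mathlib.Algebra.CharP.Lemmas
import HarnessLib

/-!
# Local expansions for the Garcia–Stichtenoth tower (the `O(1)`-calculus of [GS96, (3.5)–(3.11)])

Topic: `Literature/NumberTheory/DiophantineGeometry` (sub-namespace `GSTower`). The tower of
[Stichtenoth 2009, Def. 7.4.1] is `x_{i+1}^q - x_{i+1} = u(x_i)` with

  `u(z) = z^q / (1 - z^{q-1})`       (`GSTower.u`).

Its ramification structure ([Garcia–Stichtenoth 1996, Lemmas 3.3–3.5] = [Stichtenoth 2009,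
Lemmas 7.4.5–7.4.6]) rests on a handful of local expansions at a place `P`, which this file proves
once and for all, writing `f = g + O(1)` as `f - g ∈ 𝒪_P`:

* `ord_u_of_ord_neg`: `v_P(z) < 0 ⇒ v_P(u(z)) = v_P(z)`; `u_add_self_mem`: `u(z) = -z + O(1)` (E4);
* `inv_u`: `1/u(z) = z^{-q} - z^{-1}` (E2);
* `inv_add_inv_mem_of_pow_sub_eq`: if `y ≡ 0` and `y^q - y = U` then `1/y = -1/U + O(1)` (E1)
  [GS96, (3.5), (3.10)];
* `u_sub_div_mem`: if `z ≡ α` with `α^q = α ≠ 0` (a constant) then `u(z) = α²/(z - α) + O(1)` (E3)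
  [GS96, (3.6)–(3.7)], in characteristic dividing `q`;
* `sub_pow_sub_sub`: the Artin–Schreier shift `(y - z)^q - (y - z) = (y^q - y) - (z^q - z)` (`q = pⁿ`).

## References

* A. Garcia, H. Stichtenoth, *On the asymptotic behaviour of some towers of function fields over
  finite fields*, J. Number Theory 61 (1996) 248–273: §3, (3.5)–(3.11). [cited through Stichtenoth2009]
* H. Stichtenoth, *Algebraic Function Fields and Codes*, 2nd ed., GTM 254 (2009): Def. 7.4.1,
  Lemma 7.4.3, proof of Lemma 7.4.6. [Stichtenoth2009]
-/

noncomputable section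

open scoped Classical Polynomial
open Polynomial

namespace Literature.NumberTheory.DiophantineGeometry

open AlgFunctionField

namespace GSTower

universe u v

section U

variable {F : Type v} [Field F]

/-- The right hand side `u(z) = z^q / (1 - z^{q-1})` of the defining equation
`x_{i+1}^q - x_{i+1} = u(x_i)` of the tower. [cite: Stichtenoth2009, Def. 7.4.1 (7.14)] -/
def u (q : ℕ) (z : F) : F :=
  z ^ q / (1 - z ^ (q - 1))

/-- `u` commutes with ring homomorphisms of fields. [folklore] -/
theorem map_u {F' : Type*} [Field F'] (f : F →+* F') (q : ℕ) (z : F) : f (u q z) = u q (f z) := by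
  simp [u, map_div₀]

/-- **(E2)** `1/u(z) = z^{-q} - z^{-1}` (`z ≠ 0`, `z^{q-1} ≠ 1`, `q ≥ 1`). [folklore] -/
theorem inv_u {q : ℕ} (hq : 1 ≤ q) {z : F} (hz : z ≠ 0) :
    (u q z)⁻¹ = (z ^ q)⁻¹ - z⁻¹ := by
  rw [u, inv_div, sub_div, one_div]
  congr 1
  rw [eq_comm, inv_eq_iff_eq_inv, inv_div, eq_div_iff (pow_ne_zero _ hz), ← pow_succ',
    Nat.sub_add_cancel hq]

/-- `u(z) + z = z / (1 - z^{q-1})` (`z^{q-1} ≠ 1`, `q ≥ 1`). [folklore] -/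
theorem u_add_self {q : ℕ} (hq : 1 ≤ q) {z : F} (h1 : 1 - z ^ (q - 1) ≠ 0) :
    u q z + z = z / (1 - z ^ (q - 1)) := by
  rw [u, div_add' _ _ _ h1, mul_sub, mul_one, ← pow_succ', Nat.sub_add_cancel hq]
  ring_nf

variable {K : Type u} [Field K] [Algebra K F]

/-- **`v_P(u(z)) = v_P(z)` at a pole of `z`** (`q ≥ 2`): `v(z^q) = q v(z)` and
`v(1 - z^{q-1}) = (q-1) v(z)` by the strict triangle inequality. In particular `u(x_N)` has a simple
pole wherever `x_N` has. [cite: Stichtenoth2009, Lemma 7.4.3 (proof)] -/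
theorem ord_u_of_ord_neg (P : PlaceOver K F) {q : ℕ} (hq : 2 ≤ q) {z : F} (hz : P.ord z < 0) :
    (1 - z ^ (q - 1) ≠ 0 ∧ P.ord (1 - z ^ (q - 1)) = (q - 1 : ℕ) * P.ord z) ∧ P.ord (u q z) = P.ord z := by
  have hz0 : z ≠ 0 := P.ne_zero_of_ord_ne_zero hz.ne
  have hpow : P.ord (-z ^ (q - 1)) = (q - 1 : ℕ) * P.ord z := by rw [P.ord_neg, P.ord_pow hz0]
  have hlt : P.ord (-z ^ (q - 1)) < P.ord (1 : F) := by
    rw [hpow, P.ord_one]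
    have : (1 : ℤ) ≤ ((q - 1 : ℕ) : ℤ) := by omega
    nlinarith
  have hst := P.ord_add_eq_left_of_lt (neg_ne_zero.2 (pow_ne_zero _ hz0)) one_ne_zero hlt
  rw [neg_add_eq_sub] at hst
  refine ⟨⟨hst.1, hst.2.trans hpow⟩, ?_⟩
  rw [u, P.ord_div (pow_ne_zero _ hz0) hst.1, P.ord_pow hz0, hst.2, hpow]
  have : ((q : ℕ) : ℤ) = ((q - 1 : ℕ) : ℤ) + 1 := by omega
  rw [this]; ring

/-- **(E4)** `u(z) = -z + O(1)` at a pole of `z`: `u(z) + z = z/(1 - z^{q-1})` has order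
`(2 - q) v_P(z) ≥ 0`. [cite: Stichtenoth2009, Lemma 7.4.6 (proof)] -/
theorem u_add_self_mem (P : PlaceOver K F) {q : ℕ} (hq : 2 ≤ q) {z : F} (hz : P.ord z < 0) :
    u q z + z ∈ P.toValuationSubring := by
  have hz0 : z ≠ 0 := P.ne_zero_of_ord_ne_zero hz.ne
  obtain ⟨⟨h1, hord⟩, -⟩ := ord_u_of_ord_neg P hq hz
  rw [u_add_self (by omega) h1, P.mem_toValuationSubring_iff_ord_nonneg (div_ne_zero hz0 h1),
    P.ord_div hz0 h1, hord]
  have : (2 : ℤ) ≤ ((q - 1 : ℕ) : ℤ) + 1 := by omega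
  nlinarith

/-- **(E1)** If `v_P(y) > 0` and `y^q - y = U` (`q ≥ 2`) then `v_P(U) = v_P(y)` and
`1/y + 1/U = y^{q-1}/U ∈ 𝒪_P`, i.e. `1/y = -1/U + O(1)` ([GS96, (3.5), (3.10)]).
[cite: Stichtenoth2009, Lemma 7.4.6 (proof)] -/
theorem inv_add_inv_mem_of_pow_sub_eq (P : PlaceOver K F) {q : ℕ} (hq : 2 ≤ q) {y U : F}
    (hy : 0 < P.ord y) (hU : y ^ q - y = U) :
    U ≠ 0 ∧ P.ord U = P.ord y ∧ y⁻¹ + U⁻¹ ∈ P.toValuationSubring := by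
  have hy0 : y ≠ 0 := P.ne_zero_of_ord_ne_zero hy.ne'
  have hlt : P.ord (-y) < P.ord (y ^ q) := by
    rw [P.ord_neg, P.ord_pow hy0]; nlinarith
  have hst := P.ord_add_eq_left_of_lt (neg_ne_zero.2 hy0) (pow_ne_zero _ hy0) hlt
  rw [neg_add_eq_sub, hU, P.ord_neg] at hst
  refine ⟨hst.1, hst.2, ?_⟩
  have heq : y⁻¹ + U⁻¹ = y ^ (q - 1) / U := by
    have hq' : y ^ q = y ^ (q - 1) * y := by rw [← pow_succ, Nat.sub_add_cancel (by omega : 1 ≤ q)]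
    rw [eq_div_iff hst.1, add_mul, inv_mul_cancel₀ hst.1, ← hU, hq']
    field_simp
    ring
  rw [heq, P.mem_toValuationSubring_iff_ord_nonneg (div_ne_zero (pow_ne_zero _ hy0) hst.1),
    P.ord_div (pow_ne_zero _ hy0) hst.1, P.ord_pow hy0, hst.2]
  have : (1 : ℤ) ≤ ((q - 1 : ℕ) : ℤ) := by omega
  nlinarith

/-- **(E3)** If `z ≡ α (mod P)` for a constant `α` with `α^q = α ≠ 0` and `q = 0` in `K`, then
`u(z) - α²/(z - α) ∈ 𝒪_P`, i.e. `u(z) = α²/(z - α) + O(1)` ([GS96, (3.6)–(3.7)]: with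
`1 - X^{q-1} = -(X - α) S(X)`, `S(α) = (q-1)α^{q-2} = -α^{q-2} ≠ 0`, the numerator `X^q + α² S(X)`
vanishes at `α`). [cite: Stichtenoth2009, Lemma 7.4.6 (proof)] -/
theorem u_sub_div_mem [IsAlgFunctionField K F] (P : PlaceOver K F) {q : ℕ} (hq : 2 ≤ q)
    (hqK : (q : K) = 0) {α : K}
    (hαq : α ^ q = α) (hα0 : α ≠ 0) {z : F} (hz : 0 < P.ord (z - algebraMap K F α)) :
    u q z - algebraMap K F (α ^ 2) / (z - algebraMap K F α) ∈ P.toValuationSubring := by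
  set a := algebraMap K F α with ha
  have hδ0 : z - a ≠ 0 := P.ne_zero_of_ord_ne_zero hz.ne'
  have hza : z ≠ a := sub_ne_zero.1 hδ0
  have hαpow : α ^ (q - 1) = 1 := by
    have : α ^ (q - 1) * α = 1 * α := by rw [← pow_succ, Nat.sub_add_cancel (by omega), hαq, one_mul]
    exact mul_right_cancel₀ hα0 this
  -- `S(X) = Σ_{i<q-1} X^i α^{q-2-i}`, `(X - α) S = X^{q-1} - 1`
  set S : K[X] := ∑ i ∈ Finset.range (q - 1), X ^ i * C α ^ (q - 1 - 1 - i) with hS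
  have hSmul : S * (X - C α) = X ^ (q - 1) - 1 := by
    rw [hS, geom_sum₂_mul, ← C_pow, hαpow, C_1]
  have hSeval : S.eval α = ((q - 1 : ℕ) : K) * α ^ (q - 2) := by
    rw [hS, eval_finsetSum]
    simp only [eval_mul, eval_pow, eval_X, eval_C]
    rw [Finset.sum_congr rfl fun i (hi : i ∈ Finset.range (q - 1)) => by
      rw [← pow_add, show i + (q - 1 - 1 - i) = q - 2 by
        have := Finset.mem_range.1 hi; omega]]
    rw [Finset.sum_const, Finset.card_range, nsmul_eq_mul]
  have hcast : ((q - 1 : ℕ) : K) + 1 = (q : K) := by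
    rw [← Nat.cast_add_one]; congr 1; omega
  have hSeval0 : S.eval α ≠ 0 := by
    rw [hSeval]
    refine mul_ne_zero ?_ (pow_ne_zero _ hα0)
    have : ((q - 1 : ℕ) : K) = -1 := by
      rw [hqK] at hcast; exact eq_neg_of_add_eq_zero_left hcast
    rw [this]; exact neg_ne_zero.2 one_ne_zero
  -- the numerator `N = X^q + α² S` vanishes at `α`
  set N : K[X] := X ^ q + C (α ^ 2) * S with hN
  have hNroot : N.IsRoot α := by
    rw [IsRoot.def, hN, eval_add, eval_pow, eval_X, eval_mul, eval_C, hSeval, hαq]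
    have h1 : α ^ 2 * (((q - 1 : ℕ) : K) * α ^ (q - 2)) = ((q - 1 : ℕ) : K) * α ^ q := by
      rw [show α ^ q = α ^ 2 * α ^ (q - 2) by rw [← pow_add, Nat.add_sub_cancel' hq]]; ring
    rw [h1, hαq]
    linear_combination (α : K) * hcast + α * hqK
  obtain ⟨M, hM⟩ : (X - C α) ∣ N := dvd_iff_isRoot.2 hNroot
  -- evaluate at `z`
  have hSz : P.valuation (aeval z S) = 1 := P.valuation_aeval_eq_one hz hza S hSeval0
  have hSz0 : aeval z S ≠ 0 := by
    intro h0; rw [h0, Valuation.map_zero] at hSz; exact zero_ne_one hSz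
  have h1z : 1 - z ^ (q - 1) = -((z - a) * aeval z S) := by
    have := congrArg (aeval z) hSmul
    rw [map_mul, map_sub, aeval_X, aeval_C, map_sub, map_pow, aeval_X, map_one] at this
    linear_combination this
  have hNz : z ^ q + algebraMap K F (α ^ 2) * aeval z S = (z - a) * aeval z M := by
    have := congrArg (aeval z) hM
    rwa [hN, map_add, map_pow, aeval_X, map_mul, aeval_C, map_mul, map_sub, aeval_X, aeval_C] at this
  have key : u q z - algebraMap K F (α ^ 2) / (z - a) = -(aeval z M / aeval z S) := by
    rw [u, h1z]
    field_simp
    linear_combination -hNz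
  rw [key]
  refine neg_mem ?_
  rw [← P.toValuationSubring.valuation_le_one_iff]
  change P.valuation _ ≤ 1
  rw [map_div₀, hSz, div_one]
  exact P.valuation_aeval_le_one hz hza M

/-! ### The Artin–Schreier shift -/

/-- **Artin–Schreier shift**: `(y - z)^q - (y - z) = (y^q - y) - (z^q - z)` for `q = pⁿ` in
characteristic `p`. [cite: Stichtenoth2009, Lemma 3.7.7 (proof)] -/
theorem sub_pow_sub_sub {p : ℕ} [Fact p.Prime] [CharP F p] (n : ℕ) (y z : F) :
    (y - z) ^ p ^ n - (y - z) = (y ^ p ^ n - y) - (z ^ p ^ n - z) := by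
  rw [sub_pow_char_pow]; ring

/-- Shifting by a constant `α` with `α^q = α` does not change `y^q - y`.
[cite: Stichtenoth2009, Lemma 3.7.7 (proof)] -/
theorem sub_algebraMap_pow_sub {p : ℕ} [Fact p.Prime] [CharP F p] (n : ℕ) (y : F) {α : K}
    (hα : α ^ p ^ n = α) :
    (y - algebraMap K F α) ^ p ^ n - (y - algebraMap K F α) = y ^ p ^ n - y := by
  rw [sub_pow_sub_sub, ← map_pow, hα, sub_self, sub_zero]

end U

end GSTower

end Literature.NumberTheory.DiophantineGeometry
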